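import Summits.QuantumFields.YangMills.Theorems.BalabanUVNodesN15AtSpineCarriersVWordsSite
import Summits.QuantumFields.YangMills.Theorems.BalabanUVNodesN15VectorPieceUnit

/-!
# YM-DAG node N15 (= NE2) AT THE RATE CARRIERS OF RECORD — ALL THREE CONJUNCTS OF `N15At` BY NAME ON ONE BACKGROUND-LIVE FAMILY: operator layer (`vWGCVecFamily4`, g4 F16),
# site-kernel layer (`vWGCVecSiteKernel`, S6) AND unit-lattice layer (`vWGCVecUnitKernel`, U4) for the U = 1 vector piece ⊗ 1_𝔤 dressed by the (3.60)-shaped full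
# perturbation — `N15At` and the K4 stub `S_N15 RRec` FROM `U ≡ 1` DATA ALONE (the `U ≡ 1` site kernels and the `U ≡ 1` unit covariances, displayed)

Track A of `YM-PLAN.md` (cell `pub-ymgap`, HUMAN RULING D-0062), node **N15**; typed by seat `pub-ymgap-dag-n15-c` (generation g5) as the capstone of its g0–g5 background chain.  Shape
twin: this seat's S7 `…AtSpineCarriersVWordsSite` (same namespace; nothing restated — that file keeps the faces with the unit layer DISPLAYED).  Producers consumed BY NAME:
`VectorPiece.ne2PlusOperator_vectorPiece_vWordsExpC` ∕ `…LinC` (F16), `VectorPiece.ne2PlusSite_vectorPiece_vWordsExpC` ∕ `…LinC` (S6), `VectorPiece.ne2PlusUnit_vectorPiece_vWordsExpC` ∕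
`…LinC` (U4).  Kernel bookkeeping: 1 `def`, 0 `sorry`, standard axioms.  COUNT-NEUTRAL; `--supports` the K3⁗ item `SpineGivenEndpointR13Sep` (stmt-QuantumFields-20292, `--as helper`).

THE STUB.  `S_N15 RRec := ∀ F D g₀ os R, RRec F D g₀ os R → N15At R.ne2`, `N15At c := NE2PlusOperator c.c35 c.pi c.Kop ∧ NE2PlusSite 4 c.p c.c35 c.pi c.Ksite ∧
NE2PlusUnit c.c35 c.pi c.Kunit c.inΛ c.unitDist`.

WHAT THIS MODULE IS.  `UnitDatumW` (the displayed `U ≡ 1` unit-covariance datum, twin of S7's `SiteDatumW` with the unit form `a − a²Q(G⊗1)Q*`).  §1 faces ★★★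
`n15At_vectorPiece_vWordsExpC_of_U1`, `n15At_vectorPiece_vWordsLinC_of_U1`: for `d + 1 ≥ 2`, `L ≥ 2`, `c₃₅ > 0`, ANY `p`, coordinates `e`, weight `a`: `N15At` with `Kop := vWGCVecFamily4`,
`Ksite := vWGCVecSiteKernel`, `Kunit := vWGCVecUnitKernel`, `inΛ := ⊤`, `unitDist :=` King's torus distance — ALL THREE CONJUNCTS BY NAME, hypotheses = `SiteDatumW` + `UnitDatumW`
ONLY.  §2 closers `s_N15_of_vWordsExpCU1Reading` ∕ `…LinCU1Reading`: `S_N15 RRec` for every rate-record predicate whose NE2 component IS that carrier record with some `U ≡ 1`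
data — NO layer of `N15At` is a hypothesis any more.

HONEST FRAMING.  NE2 is NOT PRINTED beyond King's scalar template and NOT PROVED for Bałaban's `G(U)` ∕ `(Q′G′²Q′*)⁻¹(U)` ∕ `C^{(k)}(Λ;U)`.  What is proved: for the LINEAR (`U ≡ 1`)
vector SINGLE-SCALE piece of [B5]∕[B6]∕King (4.42) ⊗ 1_𝔤, dressed by the (3.60)-shaped `V′(A′)` (gauge field the datum, coarse `V′₁` at the mean field's triple, parallel-transport
or linearised averaging species on the ONE-LEVEL contour), the η-rates of the dressed propagator, of the dressed site kernel and of the dressed unit form's inverse, BY NAME in the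
typed shapes, from the `U ≡ 1` two-grid estimates of n15-a∕-c and (3.35) read at the unit scale.  What stays DISPLAYED (`U ≡ 1` objects, uniform bounds — NOT η-rates): the
inverse `(Q(G⊗1)²Q*)⁻¹` and the inverse `(a − a²Q(G⊗1)Q*)⁻¹` of the PIECE with decaying majorants (`SiteDatumW`, `UnitDatumW`) — for the piece these are FORMAL analogues of
[B9] Thm 3.2 and King's `C^{(k)}` (King's identity holds for the full `G_k`).  Transport = fibrewise mean (linearised (C3)); NOT the multiscale carrier of NODE 00.  N15 is NOT
discharged (0∕1 at every record); typed 28∕28, discharged count untouched; one finite four-torus programme at fixed `ε` — NOT ℝ⁴, NOT infinite volume, NOT OS, NOT a mass gap,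
NOT Clay.  Restate-immune.  No decl below carries a cite tag.
-/

noncomputable section

open Finset

namespace Summit.QuantumFields.YangMills.Theorems.N15AtSpineCarriers

open Literature.MathematicalPhysics.QuantumFieldTheory.Balaban1983to89
open Literature.MathematicalPhysics.QuantumFieldTheory.Balaban1983to89.T4Continuum
open Literature.MathematicalPhysics.QuantumFieldTheory.Balaban1983to89.B9 (SiteKernel)
open Literature.MathematicalPhysics.QuantumFieldTheory.Balaban1983to89.B11SectG (BlockNorm HasMaj)
open Literature.MathematicalPhysics.QuantumFieldTheory.Balaban1983to89.T4EtaRate (PairedInstance NE2PlusOperator NE2PlusSite NE2PlusUnit)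
open Literature.MathematicalPhysics.QuantumFieldTheory.Balaban1983to89.B5Prop11Plancherel (Tor fine)
open Summit.QuantumFields.YangMills.BalabanUVNodes.N15.MatrixSpecies (liftMap liftBlk)
open Summit.QuantumFields.YangMills.BalabanUVNodes.N15.SiteLayer (siteForm₀ unitForm₀)
open Summit.QuantumFields.YangMills.BalabanUVNodes.N15.VectorPiece (VecIndexS v1GVecInstance vWGCVecFamily4 vWGCVecSiteKernel vWGCVecUnitKernel linFc linFsc linFf linFsf
  expFc expFsc expFf expFsf ne2PlusOperator_vectorPiece_vWordsLinC ne2PlusOperator_vectorPiece_vWordsExpC ne2PlusSite_vectorPiece_vWordsExpC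
  ne2PlusSite_vectorPiece_vWordsLinC ne2PlusUnit_vectorPiece_vWordsExpC ne2PlusUnit_vectorPiece_vWordsLinC unitTorusGeoS blkFine kingPrV qbond tensorId pieceG rweight)
open YMDAG.UVSplit (Datum NE2Carriers RateCarriers RateRecordPred N15At RatesAt S_N15)

variable {N : ℕ} [NeZero N] {d : ℕ} {L : ℕ} [NeZero L] {ι : Type} [Fintype ι] [DecidableEq ι]
  {𝔄 : Type} [NormedRing 𝔄] [NormedAlgebra ℝ 𝔄] [CompleteSpace 𝔄] (e : 𝔄 ≃L[ℝ] (ι → ℝ)) (a : ℝ)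

/-- THE `U ≡ 1` UNIT-COVARIANCE DATUM of the faces below: coarse and fine inverses `Wu j, Wu′ j` of the unit forms `a − a²Q(G⊗1)Q*` ∕ `a − a²Q′(G′⊗1)Q′*` of the -a vector
piece on the unit-bond site lattice, with a uniform decaying majorant `β_U·e^{−δ_U d}` — King's `C^{(k)}`-type object at `U ≡ 1`, DISPLAYED. [bookkeeping] -/
def UnitDatumW (Wu Wu' : ∀ j : VecIndexS d L, ((Tor j.Mn × Fin (d + 1)) × ι → ℝ) →ₗ[ℝ] ((Tor j.Mn × Fin (d + 1)) × ι → ℝ)) (βU δU : ℝ) : Prop :=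
  0 ≤ βU ∧ 0 < δU ∧
  (∀ j, HasMaj (BlockNorm.ofBlocks (unitTorusGeoS L j.k j.Mn j.Msz) (liftBlk (fun b : Tor j.Mn × Fin (d + 1) => b.1) ι))
      (BlockNorm.ofBlocks (unitTorusGeoS L j.k j.Mn j.Msz) (liftBlk (fun b : Tor j.Mn × Fin (d + 1) => b.1) ι)) (Wu j)
      (fun y y' => βU * Real.exp (-(δU * (unitTorusGeoS L j.k j.Mn j.Msz).dist y y')))) ∧
  (∀ j, HasMaj (BlockNorm.ofBlocks (unitTorusGeoS L j.k j.Mn j.Msz) (liftBlk (fun b : Tor j.Mn × Fin (d + 1) => b.1) ι))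
      (BlockNorm.ofBlocks (unitTorusGeoS L j.k j.Mn j.Msz) (liftBlk (fun b : Tor j.Mn × Fin (d + 1) => b.1) ι)) (Wu' j)
      (fun y y' => βU * Real.exp (-(δU * (unitTorusGeoS L j.k j.Mn j.Msz).dist y y')))) ∧
  (∀ j, unitForm₀ a (liftMap (qbond L j.k j.Mn) ι) (tensorId ι (pieceG L j.Mn (L ^ j.k) j.k (rweight (d := d) L j.k))) ∘ₗ Wu j = LinearMap.id) ∧
  (∀ j, unitForm₀ a (liftMap (qbond L j.k j.Mn) ι ∘ liftMap (kingPrV L j.k j.m j.Mn) ι)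
      (tensorId ι (pieceG L j.Mn (L ^ j.m * L ^ j.k) (j.k + j.m) (rweight (d := d) L j.k / ((L : ℝ) ^ j.m) ^ (d + 1)))) ∘ₗ Wu' j = LinearMap.id)

/-! ## §1 The node faces: ALL THREE conjuncts by name, from `U ≡ 1` data alone -/

section Faces

variable {Ws Ws' Wu Wu' : ∀ j : VecIndexS d L, ((Tor j.Mn × Fin (d + 1)) × ι → ℝ) →ₗ[ℝ] ((Tor j.Mn × Fin (d + 1)) × ι → ℝ)} {βW δW βU δU : ℝ}

/-- **`N15At` WITH THE FULL PERTURBATION AND THE PARALLEL-TRANSPORT SPECIES LIVE — ALL THREE CONJUNCTS BY NAME, FROM `U ≡ 1` DATA ALONE** (`d + 1 ≥ 2`, `L ≥ 2`, `c₃₅ > 0`,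
any `p`): operator conjunct = F16's `ne2PlusOperator_vectorPiece_vWordsExpC`; site conjunct = S6's `ne2PlusSite_vectorPiece_vWordsExpC` at `SiteDatumW`; unit conjunct = U4's
`ne2PlusUnit_vectorPiece_vWordsExpC` at `UnitDatumW`. [bookkeeping] -/
theorem n15At_vectorPiece_vWordsExpC_of_U1 (hd : 1 ≤ d) (hL : 1 ≤ L) (hL2 : 2 ≤ L) {c35 : ℝ} (hc35 : 0 < c35) (p : ℝ)
    (hW : SiteDatumW (d := d) (ι := ι) (L := L) Ws Ws' βW δW) (hU : UnitDatumW (d := d) (ι := ι) (L := L) a Wu Wu' βU δU) :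
    N15At { I := VecIndexS d L, c35 := c35, p := p, pi := v1GVecInstance (d := d) 𝔄 ι L hL,
            Kop := vWGCVecFamily4 (d := d) 𝔄 ι e L a hL (expFc ι e L) (expFsc ι e L) (expFf ι e L) (expFsf ι e L),
            Ksite := vWGCVecSiteKernel (d := d) 𝔄 ι e L a hL (expFc ι e L) (expFsc ι e L) (expFf ι e L) (expFsf ι e L) Ws Ws',
            Kunit := vWGCVecUnitKernel (d := d) 𝔄 ι e L a hL (expFc ι e L) (expFsc ι e L) (expFf ι e L) (expFsf ι e L) Wu Wu',
            inΛ := fun _ _ => True, unitDist := fun j => (unitTorusGeoS L j.k j.Mn j.Msz).dist } := by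
  obtain ⟨hβW, hδW, hWs, hWs', hKW, hKW'⟩ := hW
  obtain ⟨hβU, hδU, hWu, hWu', hKU, hKU'⟩ := hU
  exact ⟨ne2PlusOperator_vectorPiece_vWordsExpC (d := d) e a hd hL c35 hc35,
    ne2PlusSite_vectorPiece_vWordsExpC (d := d) e a hd hL c35 hc35 p Ws Ws' hβW hδW hWs hWs' hKW hKW',
    ne2PlusUnit_vectorPiece_vWordsExpC (d := d) e a hd hL hL2 c35 hc35 Wu Wu' hβU hδU hWu hWu' hKU hKU'⟩

/-- **`N15At` WITH THE FULL PERTURBATION AND THE LINEARISED SPECIES LIVE — ALL THREE CONJUNCTS BY NAME, FROM `U ≡ 1` DATA ALONE.** [bookkeeping] -/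
theorem n15At_vectorPiece_vWordsLinC_of_U1 (hd : 1 ≤ d) (hL : 1 ≤ L) (hL2 : 2 ≤ L) {c35 : ℝ} (hc35 : 0 < c35) (p : ℝ)
    (hW : SiteDatumW (d := d) (ι := ι) (L := L) Ws Ws' βW δW) (hU : UnitDatumW (d := d) (ι := ι) (L := L) a Wu Wu' βU δU) :
    N15At { I := VecIndexS d L, c35 := c35, p := p, pi := v1GVecInstance (d := d) 𝔄 ι L hL,
            Kop := vWGCVecFamily4 (d := d) 𝔄 ι e L a hL (linFc ι e L) (linFsc ι e L) (linFf ι e L) (linFsf ι e L),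
            Ksite := vWGCVecSiteKernel (d := d) 𝔄 ι e L a hL (linFc ι e L) (linFsc ι e L) (linFf ι e L) (linFsf ι e L) Ws Ws',
            Kunit := vWGCVecUnitKernel (d := d) 𝔄 ι e L a hL (linFc ι e L) (linFsc ι e L) (linFf ι e L) (linFsf ι e L) Wu Wu',
            inΛ := fun _ _ => True, unitDist := fun j => (unitTorusGeoS L j.k j.Mn j.Msz).dist } := by
  obtain ⟨hβW, hδW, hWs, hWs', hKW, hKW'⟩ := hW
  obtain ⟨hβU, hδU, hWu, hWu', hKU, hKU'⟩ := hU
  exact ⟨ne2PlusOperator_vectorPiece_vWordsLinC (d := d) e a hd hL c35 hc35,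
    ne2PlusSite_vectorPiece_vWordsLinC (d := d) e a hd hL c35 hc35 p Ws Ws' hβW hδW hWs hWs' hKW hKW',
    ne2PlusUnit_vectorPiece_vWordsLinC (d := d) e a hd hL hL2 c35 hc35 Wu Wu' hβU hδU hWu hWu' hKU hKU'⟩

end Faces

/-! ## §2 (W2) closers: `S_N15` for every rate-record predicate whose NE2 component IS one of the two families with some `U ≡ 1` data — no layer is a hypothesis -/

section Closers

/-- **`S_N15` FOR EVERY PARALLEL-TRANSPORT-SPECIES READING WITH `U ≡ 1` DATA**: NONE of the three layers is a hypothesis. [bookkeeping] -/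
theorem s_N15_of_vWordsExpCU1Reading (hd : 1 ≤ d) (hL : 1 ≤ L) (hL2 : 2 ≤ L) (RRec : RateRecordPred N)
    (hread : ∀ (F : T4Family) (D : Datum F N) (g₀ : ℕ → ℝ) (os : List (ULoop F)) (R : RateCarriers N), RRec F D g₀ os R →
      ∃ (c35 a p βW δW βU δU : ℝ) (Ws Ws' Wu Wu' : ∀ j : VecIndexS d L, ((Tor j.Mn × Fin (d + 1)) × ι → ℝ) →ₗ[ℝ] ((Tor j.Mn × Fin (d + 1)) × ι → ℝ)),
        0 < c35 ∧ SiteDatumW (d := d) (ι := ι) (L := L) Ws Ws' βW δW ∧ UnitDatumW (d := d) (ι := ι) (L := L) a Wu Wu' βU δU ∧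
        R.ne2 = { I := VecIndexS d L, c35 := c35, p := p, pi := v1GVecInstance (d := d) 𝔄 ι L hL,
                  Kop := vWGCVecFamily4 (d := d) 𝔄 ι e L a hL (expFc ι e L) (expFsc ι e L) (expFf ι e L) (expFsf ι e L),
                  Ksite := vWGCVecSiteKernel (d := d) 𝔄 ι e L a hL (expFc ι e L) (expFsc ι e L) (expFf ι e L) (expFsf ι e L) Ws Ws',
                  Kunit := vWGCVecUnitKernel (d := d) 𝔄 ι e L a hL (expFc ι e L) (expFsc ι e L) (expFf ι e L) (expFsf ι e L) Wu Wu',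
                  inΛ := fun _ _ => True, unitDist := fun j => (unitTorusGeoS L j.k j.Mn j.Msz).dist }) :
    S_N15 RRec := by
  intro F D g₀ os R hR
  obtain ⟨c35, a, p, βW, δW, βU, δU, Ws, Ws', Wu, Wu', hc35, hW, hU, hne2⟩ := hread F D g₀ os R hR
  rw [hne2]
  exact n15At_vectorPiece_vWordsExpC_of_U1 e a hd hL hL2 hc35 p hW hU

/-- **`S_N15` FOR EVERY LINEARISED-SPECIES READING WITH `U ≡ 1` DATA.** [bookkeeping] -/
theorem s_N15_of_vWordsLinCU1Reading (hd : 1 ≤ d) (hL : 1 ≤ L) (hL2 : 2 ≤ L) (RRec : RateRecordPred N)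
    (hread : ∀ (F : T4Family) (D : Datum F N) (g₀ : ℕ → ℝ) (os : List (ULoop F)) (R : RateCarriers N), RRec F D g₀ os R →
      ∃ (c35 a p βW δW βU δU : ℝ) (Ws Ws' Wu Wu' : ∀ j : VecIndexS d L, ((Tor j.Mn × Fin (d + 1)) × ι → ℝ) →ₗ[ℝ] ((Tor j.Mn × Fin (d + 1)) × ι → ℝ)),
        0 < c35 ∧ SiteDatumW (d := d) (ι := ι) (L := L) Ws Ws' βW δW ∧ UnitDatumW (d := d) (ι := ι) (L := L) a Wu Wu' βU δU ∧
        R.ne2 = { I := VecIndexS d L, c35 := c35, p := p, pi := v1GVecInstance (d := d) 𝔄 ι L hL,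
                  Kop := vWGCVecFamily4 (d := d) 𝔄 ι e L a hL (linFc ι e L) (linFsc ι e L) (linFf ι e L) (linFsf ι e L),
                  Ksite := vWGCVecSiteKernel (d := d) 𝔄 ι e L a hL (linFc ι e L) (linFsc ι e L) (linFf ι e L) (linFsf ι e L) Ws Ws',
                  Kunit := vWGCVecUnitKernel (d := d) 𝔄 ι e L a hL (linFc ι e L) (linFsc ι e L) (linFf ι e L) (linFsf ι e L) Wu Wu',
                  inΛ := fun _ _ => True, unitDist := fun j => (unitTorusGeoS L j.k j.Mn j.Msz).dist }) :
    S_N15 RRec := by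
  intro F D g₀ os R hR
  obtain ⟨c35, a, p, βW, δW, βU, δU, Ws, Ws', Wu, Wu', hc35, hW, hU, hne2⟩ := hread F D g₀ os R hR
  rw [hne2]
  exact n15At_vectorPiece_vWordsLinC_of_U1 e a hd hL hL2 hc35 p hW hU

end Closers

end Summit.QuantumFields.YangMills.Theorems.N15AtSpineCarriers

end
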